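import Literature.NumberTheory.EllipticCurves.Kim2025.LargeImageStructureOPEN
import Literature.NumberTheory.EllipticCurves.KuriharaNumberInvariants
import HarnessLib

/-!
# Kim 2025 (arXiv:2505.09121v1, PREPRINT) Thm. 1.1 ("BSD"), second clause, at EVERY prime `p ≥ 3`
# under large image, EVERY analytic rank — typed in the tree's `∂`-vocabulary as an explicitly
# labelled OPEN hypothesis (one `def … : Prop`, nothing asserted)

Topic `NumberTheory/EllipticCurves`, sub-directory `Kim2025`; sequel of `LargeImageStructureOPEN` (same
seat: cell `b2b-bsdres`, team n1011, p09, OWNERS row T-a4; same HONEST FRAMING, verbatim there: the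
cell deletes COMBINATION-SHAPED residual classes of BSD for analytic rank `≤ 1` from PUBLISHED theorems
and TYPES the rest; an ANNOUNCED preprint enters ONLY as an `_OPEN` hypothesis
`[claim: Kim2025RefinedTNC, status: under-review]`; nothing here is a theorem of the tree). The verbatim
quotes of Kim 2025 Thm. 1.1 / Thm. 1.2 / Cor. 1.7 / §1.4.4 / Def. 2.2 / Rem. 2.3 / §3.2.2 and of
Sakamoto JTNB 36 (2024) Thm. 1.1 (the REFEREED `p = 3` Kolyvagin-system input) are in the module
docstring of `LargeImageStructureOPEN`; the dictionary `λ^+ ↔ (√−1/2π)·plusSymbol`, integral period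
`Ω = p^v·Ω⁺_f`, is in its APPEND section. This file adds the general-rank clause, which needs the
invariants `ord(δ̃)`, `∂^{(i)}(δ̃)`, `∂^{(∞)}(δ̃)` of `KuriharaNumberInvariants` (cc-typer-1, p249101),
kept out of the first file to respect the 400-line budget.
-/

noncomputable section

open scoped MatrixGroups ModularForm Classical

open CongruenceSubgroup Literature.NumberTheory.EllipticCurves.ModularForms

namespace Literature.NumberTheory.EllipticCurves.Kim2025

/-! ### Thm. 1.1 ("BSD"), SECOND clause, EVERY analytic rank, in [K25]'s own currency and the tree's
`∂`-vocabulary (referee-1 RA3 (iii) service for team n1011)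

Kim 2025 Thm. 1.1 ("BSD") (PDF p. 5, verbatim in the module docstring of `LargeImageStructureOPEN`): under large image and
non-vanishing of the collection, "`cork_𝒪 Sel(ℚ, W_f^†) = ord(δ^{min,†})`,
`length_𝒪 Sel(ℚ, W_f^†)_{/div} = ∂^{(ord(δ^{min,†}))}(δ^{min,†}) − ∂^{(∞)}(δ^{min,†})`." With `Ш(E/ℚ)`
finite, `Sel_{p^∞}(E/ℚ)_{/div} = Ш(E/ℚ)[p^∞]` (the divisible part is `E(ℚ) ⊗ ℚ_p/ℤ_p`), so the second
clause reads `length_{ℤ_p} Ш(E/ℚ)[p^∞] = ∂^{(ord(δ̃))}(δ̃) − ∂^{(∞)}(δ̃)` — the EXACT shape of Kim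
AJM 148 Thm. 1.8 (6), now at every `p ≥ 3`. In the tree's vocabulary (`kuriharaVanishingOrder`,
`kuriharaPartial`, `kuriharaPartialInfty` of `KuriharaNumberInvariants`: `Ω⁺_f`-normalised Kurihara
numbers over the CYCLIC Kolyvagin levels `#Ẽ(𝔽_ℓ)[p] ≤ p` of the printed proof; by Kim 2025 Thm. 3.12
`∂^{(s)}` is finite for `s ≥ ord` and `∂^{(r)} − ∂^{(∞)}` does not see the normalisation) the body
below is LITERALLY the cell's per-pair predicate `Summit.BirchSwinnertonDyer.Rank1Residual.X4.KimShaLengthAt W p f`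
(file `Summits/…/X4/KimShaLength.lean`, cc-typer-1; not importable from `Literature/`, hence inlined),
under the binders `3 ≤ p`, tower, `Ш(E/ℚ)` finite, newform `f` of `W`, and `Ω⁺_f` an integral period
(`0 ≤ ord_p [r]⁺_f` whenever `[r]⁺_f ≠ 0`, so that the tree's mod-`p^k` numbers are genuine
reductions of Kim's `δ^Ω`, `Ω = Ω⁺_f` admissible by §1.4.4). The bridge to `X4.KimShaLengthAt` and to
team n1011's `@[conjecture]` defs at `p = 3` (referee-1 RA3 (iii)) is then a one-line application in
`Summits/…/Additive/X4KimLargeImageIntegralPeriod.lean`. -/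

/-- **OPEN HYPOTHESIS — UNREFEREED PREPRINT (arXiv:2505.09121v1, 2025), Thm. 1.1 ("BSD") second
clause with Cor. 1.7 / §1.4.4, EVERY analytic rank, weight `2`, own currency:** for `W/ℚ` globally
minimal with newform `f`, a prime `p ≥ 3` with `ρ̄_{E,p^n}` onto for all `n` (large image), `Ш(E/ℚ)`
finite, and `Ω⁺_f` an integral period of the plus symbols: for every `r ∈ ℕ` with `ord(δ̃) = r` (so
the collection does not vanish), `∂^{(∞)}(δ̃)` is a natural number `d` and
`∂^{(r)}(δ̃) = ord_p #Ш(E/ℚ)(p) + d` — i.e. "`length_𝒪 Sel(ℚ, W_f^†)_{/div} = ∂^{(ord)} − ∂^{(∞)}`"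
read with `Sel_{/div} = Ш[p^∞]`. Body = the cell predicate `X4.KimShaLengthAt W p f` verbatim. In
analytic rank `0` (`r = 0`, `∂^{(0)} = ord_p [0]⁺_f`) it specialises to the two `cor17_…` `Prop`s
of `LargeImageStructureOPEN`; in analytic rank `1` with a prime-level unit to `rankOne_…_OPEN`. The `p = 3` case rests on
Sakamoto, JTNB 36 (2024) (REFEREED). NEVER cite this `Prop` as a theorem; explicit hypothesis only.
Weaker than the announced print (`Finite W.sha`; full tower; cyclic levels of the proof), never
stronger. [claim: Kim2025RefinedTNC, status: under-review]
[cite: Kim2025RefinedTNC, Thm. 1.1 ("BSD") (PDF p. 5), Cor. 1.7, §1.1.2–1.1.3, §1.4.4, Def. 2.2, Rem. 2.3, Thm. 3.12, §3.2.2 (ANNOUNCED, typed as an OPEN hypothesis, nothing asserted)]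
[cite: Sakamoto2024KolyvaginThree, Thm. 1.1 = Thm. 4.4 (p. 920)]
[cite: Kim2022StructureSelmer, §1.4.4, §1.5.1 (PDF p. 7), Def. 2.13, Thm. 2.14 (PDF p. 14)] -/
def thm11_kimShaLength_of_integralPeriod_OPEN : Prop :=
  ∀ (W : WeierstrassCurve ℚ) [W.IsElliptic] [W.IsGloballyMinimal] (p : ℕ) [Fact p.Prime],
    3 ≤ p → (∀ n : ℕ, W.HasSurjectiveModNGaloisRep (p ^ n : ℕ)) → Finite W.sha →
    ∀ {N : ℕ} [NeZero N] (f : CuspForm (Gamma0 N) 2), IsNewformOf W f →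
    (∀ r : ℚ, ratPlusSymbol f r ≠ 0 → 0 ≤ padicValRat p (ratPlusSymbol f r)) →
    ∀ r : ℕ, kuriharaVanishingOrder W p f = r →
      ∃ d : ℕ, kuriharaPartialInfty W p f = d ∧
        kuriharaPartial W p f r =
          ((padicValNat p (Nat.card (AddCommGroup.primaryComponent W.sha p)) + d : ℕ) : ℕ∞)


end Literature.NumberTheory.EllipticCurves.Kim2025

end
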